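/-
COR-CM (cell pub-hodgecm2, stage 2 of the Hodge ladder) — count-neutral KERNEL COMBINATORICS «order 16: the quaternion doublings», part X: EVERY GROUP OF ORDER
16 WITH A QUATERNION PAIR — the classification-free dispatch onto parts VIII (this lane) and seat b23 gen 50ʼs two-group capstone (seat prover-pub-hodgecm2-b23-g54-0,
binder prover b23, gen 54; claim HOME/INBOX.md l.25095).  Theorems only (+ the noncomputable data `datumOfCentral`, `datumOfTwisted` packaging the two data);
no `decide` beyond closed identities in `ZMod 2`/`ℕ`, no certificate, no named fact, no `sorry`.  `Interfaces.lean` (C1), every E term, B01, `Transposition/*`,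
`PortJoin/*`, `D2Bridge/*` untouched.
HONEST FRAMING: `HC_CM` is NOT proved, here or anywhere in the tree; nothing here is a period, a count of record or a headline.
T5: n/a-class (hypothesis binders: `|G| = 16`, `c` central, a quaternion pair `i, j` with `i² = j² = c`; inhabited by `Q₈ × ℤ/2`, the Pauli group, `SD₁₆`, `Q₁₆`);
checker: self.
-/
import Summits.HodgeConjecture.CorCM.Census.QuaternionDoublingLaw
import Summits.HodgeConjecture.CorCM.Census.QuaternionDoublingPair
import Summits.HodgeConjecture.CorCM.Census.IndexTwoCyclicTwoGroups

/-!
# The quaternion doublings, X: every group of order `16` with a quaternion pair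

**`isLeast_card_gfaces_generate_fibreTwo_of_quaternion_pair`**: `G` of order `16`, `c` central, `i, j ∈ G` with `i` of order `4`, `i² = j² = c`, `j i j⁻¹ = i⁻¹`,
`j ∉ ⟨i⟩` (a QUATERNION PAIR: `Q = ⟨i, j⟩ ≅ Q₈ ∋ c = −1`) ⟹ **`μ(G, c) = φ₂(G, c)`** — NO further hypothesis.  Classification-free dichotomy:
* an element of order `8` ⟹ seat b23 gen 50ʼs `IndexTwoCyclic.isLeast_card_gfaces_generate_fibreTwo_of_two_group` (the rows `SD₁₆`, `Q₁₆`);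
* no element of order `8` ⟹ every `g ∉ Q` has `g² ∈ {1, c}` and normalises `Q` by an INNER pattern (`g i g⁻¹ = c^α i`, `g j g⁻¹ = c^β j` — otherwise `g i` or
  `g j` would have order `8`); `x′ = g jᵅ iᵝ` centralises `Q`; `x′² = 1` gives the datum of twist `0` on `(i, j, x′)` (`Q₈ × ℤ/2`), `x′² = c` gives the datum of
  twist `1` on `(j, ij, x′ i)` (the Pauli group) — and part VIII applies.
Part Xa (`Census/QuaternionDoublingPair.lean`) supplies the word structure of `Q = closure {i, j}` from the five relations.  All [folklore].

## References
* [Pohlmann1968] H. Pohlmann, Algebraic cycles on abelian varieties of complex multiplication type, Ann. of Math. 88 (1968), Thm 1.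
-/

namespace Summit.HodgeConjecture.CorCM.Census.QuaternionDoubling

open Finset
open Summit.HodgeConjecture.CorCM.Prior.AllgGroup.RfwfAllgGroup
open Summit.HodgeConjecture.CorCM.Census.BlockParity
open Summit.HodgeConjecture.CorCM.Census.Coinvariant

noncomputable section

variable {G : Type*} [Group G] [Fintype G] [DecidableEq G] {c i j : G}

/-! ## §1 No element of order `8`: conjugation by an element outside `Q` is an inner pattern -/

section NoEight

variable (hcard : Nat.card G = 16) (hcen : ∀ g : G, g * c = c * g) (h8 : ∀ u : G, orderOf u ≠ 8)
  (hord : orderOf i = 4) (hii : i * i = c) (hjj : j * j = c) (hji : j * i * j⁻¹ = i⁻¹) (hj : j ∉ Subgroup.zpowers i)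

omit [Fintype G] [DecidableEq G] in
include hcard h8 in
/-- In a group of order `16` with no element of order `8`, every element has `g⁴ = 1`. [folklore] -/
theorem pow_four_eq_one_of_no_eight (g : G) : g ^ 4 = 1 := by
  have hdvd : orderOf g ∣ 2 ^ 4 := by simpa [hcard] using orderOf_dvd_natCard g
  obtain ⟨m, hm, hgm⟩ := (Nat.dvd_prime_pow Nat.prime_two).mp hdvd
  have hm3 : m ≠ 3 := fun h => h8 g (by rw [hgm, h]; norm_num)
  have hm4 : m ≠ 4 := by
    intro h
    apply h8 (g ^ 2)
    rw [orderOf_pow' g (by norm_num), hgm, h]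
    norm_num
  have h4 : orderOf g ∣ 4 := by
    rw [hgm]
    interval_cases m
    · norm_num
    · norm_num
    · norm_num
    · exact absurd rfl hm3
    · exact absurd rfl hm4
  exact orderOf_dvd_iff_pow_eq_one.mp h4

omit [Fintype G] [DecidableEq G] in
include hcard hord hii hjj hji hj in
/-- `Q = ⟨i, j⟩` has index two. [folklore] -/
theorem index_closure_pair : (Subgroup.closure ({i, j} : Set G)).index = 2 := by
  have h := (Subgroup.closure ({i, j} : Set G)).card_mul_index
  rw [qp_card_closure hord hii hjj hji hj, hcard] at h
  omega

omit [Fintype G] [DecidableEq G] in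
include hcard h8 hord hii hjj hji hj in
/-- **An element outside `Q` squares into `{1, c}`** (no element of order `8`). [folklore] -/
theorem sq_of_notMem {g : G} (hg : g ∉ Subgroup.closure ({i, j} : Set G)) : g * g = 1 ∨ g * g = c := by
  have hQi := index_closure_pair hcard hord hii hjj hji hj
  have hggQ : g * g ∈ Subgroup.closure ({i, j} : Set G) := (Subgroup.mul_mem_iff_of_index_two hQi).mpr (by tauto)
  obtain ⟨u, hu, v, hv, hgg⟩ := (qp_mem_closure_iff hord hii hjj hji _).mp hggQ
  have hsq1 : (g * g) * (g * g) = 1 := by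
    rw [show (g * g) * (g * g) = g ^ 4 by simp only [pow_succ, pow_zero, one_mul, mul_assoc], pow_four_eq_one_of_no_eight hcard h8]
  rcases qp_sq_word hord hii hjj hji u v hv with h1 | ⟨hv0, -, h2⟩
  · rw [← hgg, hsq1] at h1; exact absurd h1.symm (qp_c_ne_one hord hii)
  · rw [hgg, hv0, pow_zero, mul_one]; exact h2

omit [Fintype G] [DecidableEq G] in
include hcard hcen h8 hord hii hjj hji hj in
/-- **Conjugation by `g ∉ Q` of a quaternion unit `q` (`q² = c`) is `q` or `c q`**: `g q g⁻¹ = (gq)² q⁻¹ (g²)⁻¹` with both squares in `{1, c}`.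
[folklore] -/
theorem conj_eq_or_of_notMem {g : G} (hg : g ∉ Subgroup.closure ({i, j} : Set G)) {q : G} (hq : q ∈ Subgroup.closure ({i, j} : Set G))
    (hqq : q * q = c) : g * q * g⁻¹ = q ∨ g * q * g⁻¹ = c * q := by
  have hc2 := qp_c_mul_c hord hii
  have hcinv : c⁻¹ = c := inv_eq_of_mul_eq_one_right hc2
  have hgq : g * q ∉ Subgroup.closure ({i, j} : Set G) := fun h =>
    hg (by simpa using (Subgroup.closure ({i, j} : Set G)).mul_mem h ((Subgroup.closure ({i, j} : Set G)).inv_mem hq))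
  have hqinv : q⁻¹ = c * q := by
    apply inv_eq_of_mul_eq_one_right
    rw [← mul_assoc, hcen q, mul_assoc, hqq, hc2]
  have key : g * q * g⁻¹ = (g * q) * (g * q) * q⁻¹ * (g * g)⁻¹ := by group
  rw [key, hqinv]
  rcases sq_of_notMem hcard h8 hord hii hjj hji hj hgq with h1 | h1 <;> rcases sq_of_notMem hcard h8 hord hii hjj hji hj hg with h0 | h0 <;>
    rw [h1, h0]
  · right; rw [one_mul, inv_one, mul_one]
  · left; rw [one_mul, hcinv, mul_assoc, hcen q, ← mul_assoc, hc2, one_mul]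
  · left; rw [← mul_assoc, hc2, one_mul, inv_one, mul_one]
  · right; rw [← mul_assoc, hc2, one_mul, hcinv, hcen q]

omit [Fintype G] [DecidableEq G] in
include hcard hcen h8 hord hii hjj hji hj in
/-- **A central-type element outside `Q`**: some `x ∉ Q` commutes with `i` and `j` (adjust any `g ∉ Q` by `1, i, j` or `ij`). [folklore] -/
theorem exists_comm_of_notMem : ∃ x : G, x ∉ Subgroup.closure ({i, j} : Set G) ∧ x * i = i * x ∧ x * j = j * x := by
  set Q := Subgroup.closure ({i, j} : Set G) with hQ
  have hiQ : i ∈ Q := Subgroup.subset_closure (Set.mem_insert _ _)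
  have hjQ : j ∈ Q := Subgroup.subset_closure (Set.mem_insert_of_mem _ rfl)
  have hc2 := qp_c_mul_c hord hii
  -- an element outside `Q`
  obtain ⟨g, hg⟩ : ∃ g : G, g ∉ Q := by
    by_contra hall
    push Not at hall
    have htop : Q = ⊤ := (Subgroup.eq_top_iff' Q).mpr hall
    have hQi := index_closure_pair hcard hord hii hjj hji hj
    rw [← hQ, htop, Subgroup.index_top] at hQi
    exact absurd hQi (by norm_num)
  have hjiinv : j * i * j⁻¹ = c * i := by rw [hji, qp_i_inv hord hii]
  have hijinv : i * j * i⁻¹ = c * j := qp_i_mul_j_mul_i_inv hord hii hjj hji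
  have houtQ : ∀ q : G, q ∈ Q → g * q ∉ Q := fun q hq h => hg (by simpa using Q.mul_mem h (Q.inv_mem hq))
  rcases conj_eq_or_of_notMem hcard hcen h8 hord hii hjj hji hj hg hiQ hii with hi0 | hi1 <;>
    rcases conj_eq_or_of_notMem hcard hcen h8 hord hii hjj hji hj hg hjQ hjj with hj0 | hj1
  · exact ⟨g, hg, mul_inv_eq_iff_eq_mul.mp hi0, mul_inv_eq_iff_eq_mul.mp hj0⟩
  · -- `j ↦ c j`: use `g i`
    refine ⟨g * i, houtQ i hiQ, mul_inv_eq_iff_eq_mul.mp ?_, mul_inv_eq_iff_eq_mul.mp ?_⟩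
    · rw [show g * i * i * (g * i)⁻¹ = g * i * g⁻¹ by group, hi0]
    · rw [show g * i * j * (g * i)⁻¹ = g * (i * j * i⁻¹) * g⁻¹ by group, hijinv, show g * (c * j) * g⁻¹ = (g * c) * j * g⁻¹ by group,
        hcen g, show c * g * j * g⁻¹ = c * (g * j * g⁻¹) by group, hj1, ← mul_assoc, hc2, one_mul]
  · -- `i ↦ c i`: use `g j`
    refine ⟨g * j, houtQ j hjQ, mul_inv_eq_iff_eq_mul.mp ?_, mul_inv_eq_iff_eq_mul.mp ?_⟩
    · rw [show g * j * i * (g * j)⁻¹ = g * (j * i * j⁻¹) * g⁻¹ by group, hjiinv, show g * (c * i) * g⁻¹ = (g * c) * i * g⁻¹ by group,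
        hcen g, show c * g * i * g⁻¹ = c * (g * i * g⁻¹) by group, hi1, ← mul_assoc, hc2, one_mul]
    · rw [show g * j * j * (g * j)⁻¹ = g * j * g⁻¹ by group, hj0]
  · -- both flipped: use `g i j`
    refine ⟨g * (i * j), houtQ (i * j) (Q.mul_mem hiQ hjQ), mul_inv_eq_iff_eq_mul.mp ?_, mul_inv_eq_iff_eq_mul.mp ?_⟩
    · rw [show g * (i * j) * i * (g * (i * j))⁻¹ = g * (i * (j * i * j⁻¹) * i⁻¹) * g⁻¹ by group, hjiinv,
        show g * (i * (c * i) * i⁻¹) * g⁻¹ = g * (i * c) * g⁻¹ by group, hcen i, show g * (c * i) * g⁻¹ = (g * c) * i * g⁻¹ by group,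
        hcen g, show c * g * i * g⁻¹ = c * (g * i * g⁻¹) by group, hi1, ← mul_assoc, hc2, one_mul]
    · rw [show g * (i * j) * j * (g * (i * j))⁻¹ = g * (i * j * i⁻¹) * g⁻¹ by group, hijinv,
        show g * (c * j) * g⁻¹ = (g * c) * j * g⁻¹ by group, hcen g, show c * g * j * g⁻¹ = c * (g * j * g⁻¹) by group, hj1,
        ← mul_assoc, hc2, one_mul]

end NoEight

/-! ## §2 The two data and the dispatch -/

section Data

variable (hcard : Nat.card G = 16) (hord : orderOf i = 4) (hii : i * i = c) (hjj : j * j = c) (hji : j * i * j⁻¹ = i⁻¹)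
  (hj : j ∉ Subgroup.zpowers i) {x : G} (hx : x ∉ Subgroup.closure ({i, j} : Set G)) (hxi : x * i = i * x) (hxj : x * j = j * x)

include hcard hord hii hjj hji hj hx hxi hxj

omit [Fintype G] [DecidableEq G] in
/-- **The datum of twist `0`** on `(i, j, x)` when the central-type element `x ∉ Q` is an involution (`G ≅ Q₈ × ℤ/2`). [folklore] -/
theorem nonempty_datum_zero (hxx : x * x = 1) : Nonempty (Datum G c 0) := by
  have hiQ : i ∈ Subgroup.closure ({i, j} : Set G) := Subgroup.subset_closure (Set.mem_insert _ _)
  have hjQ : j ∈ Subgroup.closure ({i, j} : Set G) := Subgroup.subset_closure (Set.mem_insert_of_mem _ rfl)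
  have hx' : ∀ u v : ℕ, x ≠ i ^ u * j ^ v := fun u v h =>
    hx (h ▸ mul_mem (Subgroup.pow_mem _ hiQ u) (Subgroup.pow_mem _ hjQ v))
  have h0 : cpow c (0 : ZMod 2) = 1 := if_pos rfl
  refine ⟨⟨i, j, x, hord, hii, hjj, hji, hj, hxx, ?_, ?_, hx', hcard⟩⟩
  · rw [h0, one_mul, hxi, mul_assoc, hxx, mul_one]
  · rw [h0, one_mul, hxj, mul_assoc, hxx, mul_one]

omit [DecidableEq G] in
/-- **The datum of twist `1`** on `(j, ij, x i)` when the central-type element `x ∉ Q` squares to `c` (`G ≅ Q₈ ∘ ℤ/4`, the Pauli group; `x i` is an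
involution inverting `j` and `ij`). [folklore] -/
theorem nonempty_datum_one (hcen : ∀ g : G, g * c = c * g) (hxx : x * x = c) : Nonempty (Datum G c 1) := by
  have hc2 := qp_c_mul_c hord hii
  have hc1 := qp_c_ne_one hord hii
  have hiQ : i ∈ Subgroup.closure ({i, j} : Set G) := Subgroup.subset_closure (Set.mem_insert _ _)
  have hjQ : j ∈ Subgroup.closure ({i, j} : Set G) := Subgroup.subset_closure (Set.mem_insert_of_mem _ rfl)
  have hjiq : j * i = c * i * j := qp_j_mul_i hord hii hji
  have hijinv : i * j * i⁻¹ = c * j := qp_i_mul_j_mul_i_inv hord hii hjj hji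
  have h1 : cpow c (1 : ZMod 2) = c := if_neg (by decide)
  -- the new quaternion pair `(j, ij)`
  have hord_j : orderOf j = 4 := by
    haveI : Fact (Nat.Prime 2) := ⟨Nat.prime_two⟩
    have h := orderOf_eq_prime_pow (p := 2) (n := 1) (x := j) (by rw [pow_one, pow_two, hjj]; exact hc1)
      (by rw [show 2 ^ (1 + 1) = 2 * 2 by norm_num, pow_mul, pow_two j, hjj, pow_two, hc2])
    simpa using h
  have hkk : i * j * (i * j) = c := by
    calc i * j * (i * j) = i * (j * i) * j := by group
      _ = i * (c * i * j) * j := by rw [hjiq]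
      _ = (i * c) * i * (j * j) := by group
      _ = (c * i) * i * (j * j) := by rw [hcen i]
      _ = c * (i * i) * (j * j) := by group
      _ = c := by rw [hii, hjj, hc2, one_mul]
  have hkj : i * j * j * (i * j)⁻¹ = j⁻¹ := by
    rw [show i * j * j * (i * j)⁻¹ = i * j * i⁻¹ by group, hijinv, qp_j_inv hord hii hjj]
  have hk : i * j ∉ Subgroup.zpowers j := by
    intro h
    have hi : i ∈ Subgroup.zpowers j := by
      have : i = i * j * j⁻¹ := by group
      rw [this]
      exact mul_mem h (inv_mem (Subgroup.mem_zpowers j))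
    have hle : Subgroup.zpowers i ≤ Subgroup.zpowers j := (Subgroup.zpowers_le).mpr hi
    have heq : Subgroup.zpowers i = Subgroup.zpowers j :=
      Subgroup.eq_of_le_of_card_ge hle (by rw [Nat.card_zpowers, Nat.card_zpowers, hord, hord_j])
    exact hj (heq ▸ Subgroup.mem_zpowers j)
  have hxiQ : x * i ∉ Subgroup.closure ({i, j} : Set G) := fun h =>
    hx (by simpa using mul_mem h (inv_mem hiQ))
  have hx' : ∀ u v : ℕ, x * i ≠ j ^ u * (i * j) ^ v := fun u v h =>
    hxiQ (h ▸ mul_mem (Subgroup.pow_mem _ hjQ u) (Subgroup.pow_mem _ (mul_mem hiQ hjQ) v))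
  have hxij : x * (i * j) = i * j * x := by rw [← mul_assoc, hxi, mul_assoc, hxj, mul_assoc]
  refine ⟨⟨j, i * j, x * i, hord_j, hjj, hkk, hkj, hk, ?_, ?_, ?_, hx', hcard⟩⟩
  · -- `(x i)² = x² i² = c c = 1`
    calc x * i * (x * i) = x * (i * x) * i := by group
      _ = x * (x * i) * i := by rw [hxi]
      _ = (x * x) * (i * i) := by group
      _ = 1 := by rw [hxx, hii, hc2]
  · -- `(x i) j (x i) = x² (i j i⁻¹) i² = c j`
    rw [h1]
    calc x * i * j * (x * i) = x * (i * j * x) * i := by group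
      _ = x * (x * (i * j)) * i := by rw [← hxij]
      _ = (x * x) * (i * j * i⁻¹) * (i * i) := by group
      _ = c * (c * j) * c := by rw [hxx, hijinv, hii]
      _ = (c * c) * (j * c) := by group
      _ = c * j := by rw [hc2, one_mul, (qp_commute_j_c hjj).eq]
  · -- `(x i) (i j) (x i) = x² i² (j i) = c (i j)`
    rw [h1]
    have hx2 : x * (i * (i * j)) = i * (i * j) * x := by rw [← mul_assoc, hxi, mul_assoc, hxij]; group
    calc x * i * (i * j) * (x * i) = x * (i * (i * j) * x) * i := by group
      _ = x * (x * (i * (i * j))) * i := by rw [← hx2]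
      _ = (x * x) * (i * i) * (j * i) := by group
      _ = c * c * (c * i * j) := by rw [hxx, hii, hjiq]
      _ = c * (i * j) := by rw [hc2, one_mul, mul_assoc]

end Data

/-- **EVERY GROUP OF ORDER `16` WITH A QUATERNION PAIR**: `|G| = 16`, `c` central, `i` of order `4`, `i² = j² = c`, `j i j⁻¹ = i⁻¹`, `j ∉ ⟨i⟩` ⟹
**`μ(G, c) = φ₂(G, c)`** — the rows `Q₈ × ℤ/2`, Pauli, `SD₁₆`, `Q₁₆`, classification-free. [folklore] -/
theorem isLeast_card_gfaces_generate_fibreTwo_of_quaternion_pair (hcard : Nat.card G = 16) (hcen : ∀ g : G, g * c = c * g)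
    (i j : G) (hord : orderOf i = 4) (hii : i * i = c) (hjj : j * j = c) (hji : j * i * j⁻¹ = i⁻¹) (hj : j ∉ Subgroup.zpowers i)
    (hc2 : c * c = 1) :
    IsLeast {m : ℕ | ∃ S : Finset (CMF G c →₀ ℤ), ↑S ⊆ gfaceSet G c hc2 ∧ S.card = m ∧
      hodgeSpan c hc2 ≤ Submodule.span ℤ (pairSet c) ⊔ Submodule.span ℤ (translates c S)} (fibreTwo c hc2) := by
  have hc1 : c ≠ 1 := qp_c_ne_one hord hii
  have hcardF : Fintype.card G = 2 ^ 4 := by rw [← Nat.card_eq_fintype_card, hcard]; norm_num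
  by_cases h8 : ∃ u : G, orderOf u = 8
  · -- an element of order 8: cyclic subgroup of index two (seat b23 gen 50)
    obtain ⟨u, hu⟩ := h8
    have hindex : (Subgroup.zpowers u).index = 2 := by
      have h := (Subgroup.zpowers u).card_mul_index
      rw [Nat.card_zpowers, hu, hcard] at h
      omega
    exact IndexTwoCyclic.isLeast_card_gfaces_generate_fibreTwo_of_two_group hc2 hc1 hcen u hcardF (by norm_num) hindex
  · push Not at h8
    obtain ⟨x, hx, hxi, hxj⟩ := exists_comm_of_notMem hcard hcen h8 hord hii hjj hji hj
    rcases sq_of_notMem hcard h8 hord hii hjj hji hj hx with hxx | hxx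
    · obtain ⟨D⟩ := nonempty_datum_zero hcard hord hii hjj hji hj hx hxi hxj hxx
      exact D.isLeast_card_gfaces_generate_fibreTwo
    · obtain ⟨D⟩ := nonempty_datum_one hcard hord hii hjj hji hj hx hxi hxj hcen hxx
      exact D.isLeast_card_gfaces_generate_fibreTwo



end

end Summit.HodgeConjecture.CorCM.Census.QuaternionDoubling
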